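import Literature.Probability.Percolation.TwoPointFunction
import HarnessLib

/-!
# Gladkov's three-point connectivity bound `P(abc)² ≤ 8 P(ab) P(ac) P(bc)` (Gladkov 2024, Thm. 1.1 = Thm. 6.2 (13))

Topic `Literature/Probability/Percolation`. Source: N. Gladkov, *Percolation Inequalities and
Decision Trees*, arXiv:2408.08457 (2024) [Gladkov2024]; read in the arXiv version: §1 pp. 1–2
(standing assumptions, **Theorem 1.1**), §6 p. 8 (**Theorem 6.2**, (13)–(14)), §6.3 p. 10
(implications: the Delfino–Viti constant, supercritical saturation `θ⁶ ≤ 8θ⁶`).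

**Printed statement.** Standing assumptions (p. 1, end of §1 preamble): "let `G = (V, E)` be a
locally finite connected simple graph and `P` is the probability in a Bernoulli bond percolation
model where each edge `e ∈ E` is assigned a probability `p_e` of being open." *Theorem 1.1 (see
Theorem 6.2)* (p. 2): "Let `a, b, c` be distinct vertices of graph `G`. Then
`P(abc)² ≤ 8 P(ab) P(ac) P(bc)`, (1) where `P(abc)` is the probability that `a, b` and `c` are in
the same percolation cluster." *Theorem 6.2 (cf. Theorem 1.1)* (p. 8): "For Bernoulli bond
percolation on a graph `G` with vertices `a, b, c` one has `P(abc)² ≤ 8 P(ab) P(ac) P(bc)` (13)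
and `P(abc)² ≤ 2 P(ab ∪ ac)² P(bc)`. (14)" Printed remarks: "This inequality can be seen as the
`√8` bound on the Delfino–Viti constant for every graph [DV11]. Moreover, when the graph `G` is
planar and `a, b` and `c` belong to the same face, we bring the constant `8` in (1) down to `2`"
(p. 2; Thm. 6.1, p. 7); §6.3 (p. 10): "For the supercritical mode, denote by `θ` the density of
the infinite cluster. Then equation (13) tends to `θ⁶ ≤ 8θ⁶` as `a, b` and `c` tend away from each
other."

## Contents

* `gladkov2024_thm_6_2` — the named fact (D-0014), inequality (13), transcribed below.
* `gladkov2024_thm_6_2.zd` — its specialisation to `ℤ^d` written with the two-point function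
  `tau` (one-line glue, proved).

## Transcription notes

* *Percolation model.* Vendored for the tree's HOMOGENEOUS Bernoulli bond percolation
  `bondPercolation G p` (`Percolation.lean`: every edge of `G` open independently with the same
  probability `p ∈ [0, 1]`, non-edges closed) — the special case `p_e ≡ p` of the printed
  inhomogeneous model; the vendored statement is thus never stronger than print.
* *Events.* `P(abc)` ("`a, b` and `c` are in the same percolation cluster") =
  `(bondPercolation G p).real (openConn a b ∩ openConn a c)` (`{a ↔ b} ∩ {a ↔ c}`; equality of
  the two events is reachability being an equivalence relation); `P(ab)` =
  `(bondPercolation G p).real (openConn a b)` (= `tau d p a b` on `ℤ^d`, `tau_def`).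
* *Hypotheses kept as printed:* `G` locally finite (instance argument `G.LocallyFinite`) and
  connected (`G.Connected`), `a, b, c` distinct (Thm. 1.1; Thm. 6.2 drops distinctness — the
  coincident cases are trivial since `P(aa) = 1` — but the weaker, printed-in-Thm-1.1 form is
  recorded). For `ℤ^d`: `instance (zdGraph d).LocallyFinite` (`LatticeGraph.lean`) and
  `zdGraph_preconnected_holds` (whence connectedness, `⟨0⟩` being a vertex).
* *Not vendored in this file; elsewhere in this topic (status 2026-08-25):* the discharge of this
  fact — `GladkovThreePointBoundProofs.lean` (`gladkov2024_thm_6_2_holds`), with edge-dependent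
  weights `GladkovThreePointBoundWeighted.lean` (`gladkov2024_thm_1_1_prodBernoulli`); inequality
  (14) — `GladkovThreePointBoundUnion.lean` (`gladkov2024_thm_6_2_ineq14`,
  `gladkov2024_thm_6_2_ineq14_prodBernoulli`, proved); Lemma 1.2 / Thm. 1.3 (three-cluster `ε`–`δ`
  statements) — `GladkovThreeClusterDichotomy.lean` / `GladkovThreeClusterDichotomyProofs.lean`
  (`gladkov2024_thm_1_3_holds`, `gladkov2024_lemma_1_2_prodBernoulli`); the decision-tree vdBK
  inequality (Thm. 4.3) and the Cauchy–Schwarz step (Thm. 5.2) — `DecisionTreeBK.lean`, with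
  edge-dependent weights and the decision-tree HK inequality (Thm. 3.2) — `DecisionTreeWeighted.lean`;
  Main Lemma 8.1 — `DecisionTreeGenerating.lean`. *Not in the tree:* the planar constant-`2`
  version (Thm. 6.1); Cor. 6.5 (three-point exponent); Conj. 10.1 (an open problem, p. 18).
* Mathlib has no percolation; the tree's `bondPercolation`, `openConn`, `tau` are used
  (`lean search 'Gladkov|three_point|openConn₃'`: no prior transcription; the tree has the
  UPPER tree-graph bounds `real_openConnIn_inter_le_sum` (Grimmett (6.89), k = 3) and
  `measure_openConn₄_le_tsum` (Aizenman–Newman, k = 4), which bound `P(abc)` by a SUM of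
  products, not by the product at the three points themselves).

Grounds — as the printed UPPER-direction counterpart — the crux
`Summit.CriticalPhenomena.PercolationContinuityZ3.Theses.PercTreeValue.EquilateralAntiFactorisation`
(stmt-CriticalPhenomena-7800), which asserts the REVERSE inequality with a constant `> 1`,
`(1 + δ) τ(0,a_r) τ(a_r,b_r) τ(b_r,0) ≤ P(0 ↔ a_r ↔ b_r)²`, on the critical lattice triangle of
`ℤ³`: Gladkov's theorem pins the Delfino–Viti ratio `R = P(abc)/√(P(ab)P(ac)P(bc))` in
`[0, 2√2]` on every graph; the crux asks `R² ≥ 1 + δ` uniformly in `r` at `p_c(ℤ³)`.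

## References

* N. Gladkov, *Percolation Inequalities and Decision Trees*, arXiv:2408.08457v2 (2024): Thm. 1.1
  (p. 2), Thm. 6.1 (p. 7), Thm. 6.2 (13)–(14) (p. 8), §6.3 (p. 10). [Gladkov2024]
* G. Delfino, J. Viti, *On three-point connectivity in two-dimensional percolation*, J. Phys. A 44
  (2011) 032001, doi:10.1088/1751-8113/44/3/032001 (the constant `≈ 1.022` for `ℤ²`, cited p. 10).
-/

noncomputable section

namespace Literature.Probability.Percolation

open MeasureTheory

/-- **Gladkov 2024, Theorem 1.1 = Theorem 6.2 (13): the three-point connectivity bound.** For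
Bernoulli bond percolation with edge density `p ∈ [0, 1]` on a locally finite connected simple
graph `G` and distinct vertices `a, b, c`,
`P_p(a, b, c in one open cluster)² ≤ 8 · P_p(a ↔ b) · P_p(a ↔ c) · P_p(b ↔ c)`.
Printed for independent, possibly edge-dependent probabilities `p_e`; recorded for the tree's
homogeneous `bondPercolation G p` (special case). Users take `(h : gladkov2024_thm_6_2)`.
[cite: Gladkov2024, Thm. 1.1 (p. 2) and Thm. 6.2 (13) (p. 8), arXiv:2408.08457] -/
def gladkov2024_thm_6_2 : Prop :=
  ∀ {V : Type} (G : SimpleGraph V) [G.LocallyFinite], G.Connected →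
    ∀ (p : unitInterval) (a b c : V), a ≠ b → a ≠ c → b ≠ c →
      ((bondPercolation G p).real (openConn a b ∩ openConn a c)) ^ 2 ≤
        8 * (bondPercolation G p).real (openConn a b) * (bondPercolation G p).real (openConn a c) *
          (bondPercolation G p).real (openConn b c)

/-- **Gladkov's bound on `ℤ^d`**, with the two-point function: for distinct `a, b, c ∈ ℤ^d` and
every `p`, `P_p(a ↔ b, a ↔ c)² ≤ 8 τ_p(a,b) τ_p(a,c) τ_p(b,c)` (the nearest-neighbour lattice is
locally finite, `LatticeGraph.lean`, and connected, `zdGraph_preconnected_holds`).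
[cite: Gladkov2024, Thm. 6.2 (13) (p. 8)] -/
theorem gladkov2024_thm_6_2.zd (h : gladkov2024_thm_6_2) (d : ℕ) (p : unitInterval)
    (a b c : LatticeModels.Site d) (hab : a ≠ b) (hac : a ≠ c) (hbc : b ≠ c) :
    ((bondPercolation (LatticeModels.zdGraph d) p).real (openConn a b ∩ openConn a c)) ^ 2 ≤
      8 * tau d p a b * tau d p a c * tau d p b c := by
  have hconn : (LatticeModels.zdGraph d).Connected :=
    (SimpleGraph.connected_iff _).2 ⟨LatticeModels.zdGraph_preconnected_holds, ⟨0⟩⟩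
  simpa only [tau_def] using h (LatticeModels.zdGraph d) hconn p a b c hab hac hbc

end Literature.Probability.Percolation

end
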